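import Mathlib.Analysis.PSeries
import Mathlib.Combinatorics.SimpleGraph.Finite
import Literature.MathematicalPhysics.QuantumLattice.BogoliubovInequality
import Literature.MathematicalPhysics.QuantumLattice.HeisenbergOrder
import Literature.MathematicalPhysics.QuantumLattice.ProductOperators
import Literature.MathematicalPhysics.QuantumLattice.SpinOperatorsProofs
import Literature.MathematicalPhysics.QuantumLattice.HeisenbergModelGlobalRotationProofs
import Literature.MathematicalPhysics.QuantumLattice.XYOrderDischarges
import Literature.MathematicalPhysics.QuantumLattice.LatticeToriProofs
import Literature.MathematicalPhysics.QuantumLattice.TorusTestPotential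
import HarnessLib

/-!
# The Mermin–Wagner theorem (hubbard.S12, magnetisation form): discharge of `mermin_wagner_magnetisation`

Sibling proof file of `HeisenbergOrder.lean` (item
`provefact-Literature.MathematicalPhysics.QuantumLattice.mermin_wagner_magnetisation`; the siblings
`HeisenbergOrderMerminWagner{Gauge,Torus,}Proofs.lean` discharge the long-range-order forms
`mermin_wagner`, `mermin_wagner_staggered`, `mermin_wagner_general` by the Koma–Tasaki route). No
statement of the tree is changed and **no definition or named fact is introduced**; the file proves

* `mermin_wagner_magnetisation_holds : mermin_wagner_magnetisation` — for `d ∈ {1, 2}`, every spin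
  `S = n/2`, every coupling `J` and every `β > 0`, the magnetisation per site
  `m_L(β, h) = |Λ|⁻¹ Σ_x Re ⟨Ŝᶻ_x⟩_{β,L,h}` (`torusMagnetisation`) of the nearest-neighbour Heisenberg
  model `H = J Σ_{⟨x,y⟩} Ŝ_x·Ŝ_y - h Ŝᶻ_tot` on the torus `(ℤ/Lℤ)^d` satisfies
  `∀ ε > 0, ∃ h₀ > 0, ∀ h ∈ (0, h₀), ∃ L₀, ∀ L ≥ L₀, |m_L(β, h)| < ε` (in fact with `L₀ = 0`: the
  bound is uniform in the volume, as in the source),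

through the quantitative finite-volume bound `abs_torusMagnetisation_le_sqrt`:
`|m_L(β,h)| ≤ √(β S² (2|J| S² · 64/H_R + |h| S · 4R²))` for every `R ≥ 1`, `H_R = Σ_{k<R} 1/(k+1)`.

## The printed proof and this formalisation

Mermin–Wagner (PRL 17 (1966) 1133; surveyed with the same notation in Gelfert–Nolting (2001) §3,
eqs. (41)–(52), and in Mattis (2006) §7.15, eqs. (7.222)–(7.240)) argue in five steps:
(a) Bogoliubov's inequality `|⟨[C,A]⟩|² ≤ ½β ⟨{A,A†}⟩ ⟨[[C,H],C†]⟩`;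
(b) the choice `C = Ŝ⁺(k)`, `A = Ŝ⁻(-k)`, for which `⟨[C, A]⟩ = 2N m`;
(c) the bound `½ Σ_k ⟨{A,A†}⟩ ≤ 2 N² S(S+1)`; (d) the double-commutator bound
`⟨[[C,H],C†]⟩ ≤ N (c|J| S(S+1) k² + |h m|)`; (e) the infrared divergence of `N⁻¹ Σ_k (ωk² + |hm|)⁻¹`
in `d ≤ 2`, giving `|m| ≤ const (T |ln|h||)^{-1/2}` (`d = 2`), `const T^{-2/3} |h|^{1/3}` (`d = 1`).

Steps (a)–(d) are formalised as printed, in the Hermitian and real-space form that the finite torus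
makes natural: (a) is `bogoliubov_inequality` (`BogoliubovInequality.lean`); for (b) we take
`C = Σ_x f_x Ŝˣ_x`, `A = Ŝʸ_o` with a real weight `f`, `f(o) = 1`, so that `[C, A] = i Ŝᶻ_o`
(`siteSpin_one_comm_sub`); (c) becomes `⟨(Ŝʸ_o)²⟩ ≤ S²`; (d) is the operator identity
`[C,[H,C]] = -J Σ_{⟨x,y⟩} (f_x - f_y)² (B¹_{xy} + B²_{xy}) + h Σ_x f_x² Ŝᶻ_x`
(`doubleComm_heisenberg_with_field`, `Bᵅ_{xy} = ½(Ŝᵅ_xŜᵅ_y + Ŝᵅ_yŜᵅ_x)`) with `-S² ≤ Bᵅ_{xy} ≤ S²`,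
`-S ≤ Ŝᶻ_x ≤ S`, whence the **local bound** (`sq_re_gibbsState_siteSpin_le`, any finite graph)
`(Re⟨Ŝᶻ_o⟩)² ≤ β S² (2|J| S² Σ_{⟨x,y⟩} (f_x - f_y)² + |h| S Σ_x f_x²)`.
Step (e) — the only place where `d ≤ 2` enters — is replaced by its real-space counterpart, which
avoids discrete Fourier analysis and Riemann sums on `(ℤ/Lℤ)^d` (a deliberately shorter road in
Lean; the mechanism, the non-integrability of `k⁻²` in `d ≤ 2`, i.e. the vanishing capacity of a
point, is the same): with the radial weight `f(x) = g(dist(x, o))`, `dist` the periodic `ℓ^∞` metric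
(`torusDist`) and the harmonic profile `g(r) = (H_R - H_r)/H_R` (`= 0` for `r ≥ R`), the Dirichlet
energy over the bonds of the torus is `≤ 4d Σ_r #{dist = r} (g(r) - g(r+1))² ≤ 64/H_R` for `d ≤ 2`
(shells have `≤ 4(2r+1)` sites, `(g(r) - g(r+1))² = [r<R]/((r+1)H_R)²`), while `Σ_x f_x² ≤ 4R²`,
uniformly in `L ≥ 1` and in the centre `o` (`sq_re_gibbsState_siteSpin_torus_le`). Averaging over
`o` gives `abs_torusMagnetisation_le_sqrt`, and `H_R → ∞` (`Real.tendsto_sum_range_one_div_nat_succ_atTop`)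
gives the theorem: choose `R` with `β S² · 2|J|S² · 64/H_R ≤ ε²/4`, then `h₀` with
`β S³ · 4R² · h₀ ≤ ε²/4`. The same logarithmic test function (McBryan–Spencer) serves the Koma–Tasaki
route of the sibling files (`LatticeToriProofs.exists_testFunction_two`, `TorusTestPotential.lean`).

## Sources

* N. D. Mermin, H. Wagner, *Absence of ferromagnetism or antiferromagnetism in one- or
  two-dimensional isotropic Heisenberg models*, Phys. Rev. Lett. 17 (1966) 1133–1136
  [MerminWagnerPRL1966] (not held here; statement and proof structure as reproduced in the surveys).
* A. Gelfert, W. Nolting, J. Phys. Condens. Matter 13 (2001) R505, §2.3 eq. (9) (Bogoliubov's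
  inequality), §3 eqs. (41)–(52) (the Mermin–Wagner argument) [GelfertNolting2001] (held, read).
* D. C. Mattis, *The Theory of Magnetism Made Simple* (2006), §7.15, eqs. (7.222)–(7.240)
  [Mattis2006] (held, read).
* For the real-space test function with logarithmic (harmonic) profile: O. A. McBryan, T. Spencer,
  Commun. Math. Phys. 53 (1977) 299; T. Koma, H. Tasaki, PRL 68 (1992) 3248, P1–P2 after eq. (11).

## Design notes

* Reused, not re-proved: `bogoliubov_inequality`; the pair-sum spectral calculus of
  `DuhamelTwoPoint.lean`; `onSite` algebra (`ProductOperators.lean`); the spin commutation relations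
  and Loewner bounds (`SpinOperatorsProofs.lean`, `XYOrderDischarges.lean`); the torus metric, degree,
  sphere and radial-summation lemmas (`LatticeToriProofs.lean`, `TorusTestPotential.lean`).
* The double commutator is organised through the derivation `D(X) = XC - CX`, realised as the
  linear map `LinearMap.mulRight ℂ C - LinearMap.mulLeft ℂ C` (no new definition), and the abstract
  identity `doubleComm_sum_three_mul` for `[[Σ_α XαYα, C], C]`.
* All weights are real (`f : Λ → ℝ`, cast to `ℂ`); expectations of Hermitian observables are handled
  through `Complex.re` and operator inequalities (`Matrix.gibbsState_nonneg_of_posSemidef`).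
* Consumers: `XXZInfinitesimalFieldStatesMerminWagner.lean` reuses the abstract double-commutator
  identities, the Gibbs/Loewner bounds and the harmonic-profile torus estimates of this file for the
  XXZ antiferromagnet with a STAGGERED (indeed arbitrary) field and the Koma–Tasaki (1993)
  infinitesimal-field states in `d ≤ 2`.
-/

noncomputable section

open Finset Matrix Complex
open scoped ComplexOrder MatrixOrder
open Literature.MathematicalPhysics.QuantumLattice Literature.Probability.LatticeModels

namespace Literature.MathematicalPhysics.QuantumLattice

/-! ### An abstract double-commutator identity -/

section Abstract

variable {R : Type*} [Ring R] [Algebra ℂ R]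

/-- Product rule for `X ↦ XC - CX` when the factors are "eigenvectors":
`(XY)C - C(XY) = b·XY' + a·X'Y` if `XC - CX = a·X'`, `YC - CY = b·Y'`. [folklore] -/
theorem mul_comm_sub_of_comm_sub_eq_smul {C X Y X' Y' : R} {a b : ℂ}
    (hX : X * C - C * X = a • X') (hY : Y * C - C * Y = b • Y') :
    (X * Y) * C - C * (X * Y) = b • (X * Y') + a • (X' * Y) := by
  have e : (X * Y) * C - C * (X * Y) = X * (Y * C - C * Y) + (X * C - C * X) * Y := by
    noncomm_ring
  rw [e, hX, hY, mul_smul_comm, smul_mul_assoc]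

/-- **The double commutator of an invariant bilinear with a "rotation generator"** (abstract form of
the Mermin–Wagner computation `[[Σ_α Sᵅ_x Sᵅ_y, C], C]` for `C = Σ_z f(z) Sˣ_z`): if
`X₀C - CX₀ = 0`, `X₁C - CX₁ = u·X₂`, `X₂C - CX₂ = v·X₁` and likewise for `Y` with `u', v'`, then for
`S = X₀Y₀ + X₁Y₁ + X₂Y₂`,
`(SC - CS)C - C(SC - CS) = ((u'+v)v' + (u+v')v)·X₁Y₁ + ((u'+v)u + (u+v')u')·X₂Y₂`. [folklore] -/
theorem doubleComm_sum_three_mul {C X₀ X₁ X₂ Y₀ Y₁ Y₂ : R} {u v u' v' : ℂ}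
    (hX₀ : X₀ * C - C * X₀ = 0) (hX₁ : X₁ * C - C * X₁ = u • X₂) (hX₂ : X₂ * C - C * X₂ = v • X₁)
    (hY₀ : Y₀ * C - C * Y₀ = 0) (hY₁ : Y₁ * C - C * Y₁ = u' • Y₂)
    (hY₂ : Y₂ * C - C * Y₂ = v' • Y₁) :
    ((X₀ * Y₀ + X₁ * Y₁ + X₂ * Y₂) * C - C * (X₀ * Y₀ + X₁ * Y₁ + X₂ * Y₂)) * C -
        C * ((X₀ * Y₀ + X₁ * Y₁ + X₂ * Y₂) * C - C * (X₀ * Y₀ + X₁ * Y₁ + X₂ * Y₂)) =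
      ((u' + v) * v' + (u + v') * v) • (X₁ * Y₁) +
        ((u' + v) * u + (u + v') * u') • (X₂ * Y₂) := by
  have h0 : (X₀ * Y₀) * C - C * (X₀ * Y₀) = 0 := by
    have e : (X₀ * Y₀) * C - C * (X₀ * Y₀) = X₀ * (Y₀ * C - C * Y₀) + (X₀ * C - C * X₀) * Y₀ := by
      noncomm_ring
    rw [e, hX₀, hY₀, mul_zero, zero_mul, add_zero]
  have h1 := mul_comm_sub_of_comm_sub_eq_smul hX₁ hY₁
  have h2 := mul_comm_sub_of_comm_sub_eq_smul hX₂ hY₂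
  have h12 := mul_comm_sub_of_comm_sub_eq_smul hX₁ hY₂
  have h21 := mul_comm_sub_of_comm_sub_eq_smul hX₂ hY₁
  have hS : (X₀ * Y₀ + X₁ * Y₁ + X₂ * Y₂) * C - C * (X₀ * Y₀ + X₁ * Y₁ + X₂ * Y₂) =
      (u' + v) • (X₁ * Y₂) + (u + v') • (X₂ * Y₁) := by
    have e : (X₀ * Y₀ + X₁ * Y₁ + X₂ * Y₂) * C - C * (X₀ * Y₀ + X₁ * Y₁ + X₂ * Y₂) =
        ((X₀ * Y₀) * C - C * (X₀ * Y₀)) + ((X₁ * Y₁) * C - C * (X₁ * Y₁)) +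
          ((X₂ * Y₂) * C - C * (X₂ * Y₂)) := by noncomm_ring
    rw [e, h0, h1, h2, zero_add, add_smul, add_smul]
    abel
  rw [hS]
  have e2 : ((u' + v) • (X₁ * Y₂) + (u + v') • (X₂ * Y₁)) * C -
      C * ((u' + v) • (X₁ * Y₂) + (u + v') • (X₂ * Y₁)) =
      (u' + v) • ((X₁ * Y₂) * C - C * (X₁ * Y₂)) +
        (u + v') • ((X₂ * Y₁) * C - C * (X₂ * Y₁)) := by
    simp only [add_mul, mul_add, smul_mul_assoc, mul_smul_comm, smul_sub]
    abel
  rw [e2, h12, h21]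
  simp only [smul_add, smul_smul, add_smul]
  abel

/-- Iterating a one-step "eigen-relation": if `XC - CX = u·X'` and `X'C - CX' = v·X` then
`((XC - CX)C - C(XC - CX)) = (u v)·X`. [folklore] -/
theorem doubleComm_of_comm_sub_eq_smul {C X X' : R} {u v : ℂ}
    (hX : X * C - C * X = u • X') (hX' : X' * C - C * X' = v • X) :
    (X * C - C * X) * C - C * (X * C - C * X) = (u * v) • X := by
  rw [hX, smul_mul_assoc, mul_smul_comm, ← smul_sub, hX', smul_smul]

end Abstract

/-! ### Commutators with `C = Σ_z f(z) Sˣ_z` -/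

section Spin

variable {Λ : Type*} [Fintype Λ] [DecidableEq Λ] (n : ℕ)

/-- Weighted form of `siteSpin_mul_totalSpin`: `Ŝ^a_x (Σ_z f_z Ŝ^b_z) = (Σ_z f_z Ŝ^b_z) Ŝ^a_x +
f_x ([Ŝ^a, Ŝ^b])_x` — only the site `x` term fails to commute. Tasaki (2020) §2.2,
eqs. (2.2.6), (2.2.11). [folklore] -/
theorem siteSpin_mul_sum_smul_siteSpin (f : Λ → ℂ) (x : Λ) (a b : Fin 3) :
    (siteSpin n x a * ∑ z, f z • siteSpin n z b : Op Λ (n + 1)) =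
      (∑ z, f z • siteSpin n z b) * siteSpin n x a + f x • onSite x ⁅spinVec n a, spinVec n b⁆ := by
  have key : ∀ z : Λ, (siteSpin n x a * (f z • siteSpin n z b) : Op Λ (n + 1)) =
      f z • siteSpin n z b * siteSpin n x a +
        if z = x then f x • onSite x ⁅spinVec n a, spinVec n b⁆ else 0 := by
    intro z
    by_cases hz : z = x
    · subst hz
      rw [if_pos rfl, mul_smul_comm, smul_mul_assoc, ← smul_add]
      congr 1
      simp only [siteSpin]
      rw [onSite_mul, onSite_mul, ← onSite_add', Ring.lie_def]
      congr 1
      abel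
    · rw [if_neg hz, add_zero, mul_smul_comm, smul_mul_assoc]
      congr 1
      exact onSite_mul_onSite_comm (Ne.symm hz) _ _
  calc (siteSpin n x a * ∑ z, f z • siteSpin n z b : Op Λ (n + 1))
      = ∑ z, siteSpin n x a * (f z • siteSpin n z b) := by rw [Finset.mul_sum]
    _ = ∑ z, (f z • siteSpin n z b * siteSpin n x a +
          if z = x then f x • onSite x ⁅spinVec n a, spinVec n b⁆ else 0) :=
        Finset.sum_congr rfl fun z _ => key z
    _ = (∑ z, f z • siteSpin n z b) * siteSpin n x a + f x • onSite x ⁅spinVec n a, spinVec n b⁆ := by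
        rw [Finset.sum_add_distrib, Finset.sum_ite_eq' Finset.univ x, if_pos (Finset.mem_univ x),
          Finset.sum_mul]

/-- `[Ŝˣ_x, C] = 0` for `C = Σ_z f_z Ŝˣ_z`. [folklore] -/
theorem siteSpin_zero_comm_sub (f : Λ → ℂ) (x : Λ) :
    (siteSpin n x 0 * (∑ z, f z • siteSpin n z 0) - (∑ z, f z • siteSpin n z 0) * siteSpin n x 0 :
      Op Λ (n + 1)) = 0 := by
  rw [siteSpin_mul_sum_smul_siteSpin, Ring.lie_def, sub_self, onSite_zero, smul_zero, add_zero,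
    sub_self]

/-- `[Ŝʸ_x, C] = -i f_x Ŝᶻ_x` for `C = Σ_z f_z Ŝˣ_z` (`[Sʸ, Sˣ] = -iSᶻ`). Tasaki (2020) §2.1,
eq. (2.1.1). [folklore] -/
theorem siteSpin_one_comm_sub (f : Λ → ℂ) (x : Λ) :
    (siteSpin n x 1 * (∑ z, f z • siteSpin n z 0) - (∑ z, f z • siteSpin n z 0) * siteSpin n x 1 :
      Op Λ (n + 1)) = (-(f x * I)) • siteSpin n x 2 := by
  have hc : ⁅spinVec n 1, spinVec n 0⁆ = -(I • spinVec n 2) := by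
    rw [spinVec_zero, spinVec_one, spinVec_two, ← lie_spinX_spinY, Ring.lie_def, Ring.lie_def]
    abel
  rw [siteSpin_mul_sum_smul_siteSpin, add_sub_cancel_left, hc, onSite_neg', onSite_smul', smul_neg,
    smul_smul, neg_smul]
  rfl

/-- `[Ŝᶻ_x, C] = i f_x Ŝʸ_x` for `C = Σ_z f_z Ŝˣ_z` (`[Sᶻ, Sˣ] = iSʸ`). Tasaki (2020) §2.1,
eq. (2.1.1). [folklore] -/
theorem siteSpin_two_comm_sub (f : Λ → ℂ) (x : Λ) :
    (siteSpin n x 2 * (∑ z, f z • siteSpin n z 0) - (∑ z, f z • siteSpin n z 0) * siteSpin n x 2 :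
      Op Λ (n + 1)) = (f x * I) • siteSpin n x 1 := by
  have hc : ⁅spinVec n 2, spinVec n 0⁆ = I • spinVec n 1 := by
    rw [spinVec_zero, spinVec_one, spinVec_two, lie_spinZ_spinX]
  rw [siteSpin_mul_sum_smul_siteSpin, add_sub_cancel_left, hc, onSite_smul', smul_smul]
  rfl

/-- **`[[Σ_α Ŝ^α_x Ŝ^α_y, C], C] = (f_x - f_y)² (Ŝʸ_x Ŝʸ_y + Ŝᶻ_x Ŝᶻ_y)`** for `C = Σ_z f_z Ŝˣ_z`
(the exchange part of Mermin–Wagner's double commutator, in real space). Mermin–Wagner (1966),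
p. 1134 (the double commutator bound); Gelfert–Nolting (2001) eq. (47).
[cite: MerminWagnerPRL1966, p. 1134] -/
theorem doubleComm_sum_siteSpin_mul_siteSpin (f : Λ → ℂ) (x y : Λ) :
    (((∑ a : Fin 3, siteSpin n x a * siteSpin n y a) * (∑ z, f z • siteSpin n z 0) -
        (∑ z, f z • siteSpin n z 0) * (∑ a : Fin 3, siteSpin n x a * siteSpin n y a)) *
          (∑ z, f z • siteSpin n z 0) -
      (∑ z, f z • siteSpin n z 0) *
        ((∑ a : Fin 3, siteSpin n x a * siteSpin n y a) * (∑ z, f z • siteSpin n z 0) -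
          (∑ z, f z • siteSpin n z 0) * (∑ a : Fin 3, siteSpin n x a * siteSpin n y a)) :
      Op Λ (n + 1)) =
      (f x - f y) ^ 2 • (siteSpin n x 1 * siteSpin n y 1 + siteSpin n x 2 * siteSpin n y 2) := by
  rw [Fin.sum_univ_three]
  rw [doubleComm_sum_three_mul (siteSpin_zero_comm_sub n f x) (siteSpin_one_comm_sub n f x)
    (siteSpin_two_comm_sub n f x) (siteSpin_zero_comm_sub n f y) (siteSpin_one_comm_sub n f y)
    (siteSpin_two_comm_sub n f y), smul_add]
  congr 2
  · ring_nf
    rw [I_sq]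
    ring
  · ring_nf
    rw [I_sq]
    ring

/-- **`[[Ŝᶻ_x, C], C] = f_x² Ŝᶻ_x`** for `C = Σ_z f_z Ŝˣ_z` (the field part of Mermin–Wagner's
double commutator). Mermin–Wagner (1966), p. 1134. [cite: MerminWagnerPRL1966, p. 1134] -/
theorem doubleComm_siteSpin_two (f : Λ → ℂ) (x : Λ) :
    ((siteSpin n x 2 * (∑ z, f z • siteSpin n z 0) - (∑ z, f z • siteSpin n z 0) * siteSpin n x 2) *
          (∑ z, f z • siteSpin n z 0) -
      (∑ z, f z • siteSpin n z 0) *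
        (siteSpin n x 2 * (∑ z, f z • siteSpin n z 0) - (∑ z, f z • siteSpin n z 0) * siteSpin n x 2) :
      Op Λ (n + 1)) = (f x) ^ 2 • siteSpin n x 2 := by
  rw [doubleComm_of_comm_sub_eq_smul (siteSpin_two_comm_sub n f x) (siteSpin_one_comm_sub n f x)]
  congr 1
  ring_nf
  rw [I_sq]
  ring

end Spin


/-! ### The double commutator of the Heisenberg Hamiltonian in a field -/

section Hamiltonian

variable {Λ : Type*} [Fintype Λ] [DecidableEq Λ] (n : ℕ) (G : SimpleGraph Λ) [DecidableRel G.Adj]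

/-- `[[Ŝ_x · Ŝ_y, C], C] = (f_x - f_y)² (B¹_{xy} + B²_{xy})` for the symmetrised exchange operator
`spinDot` and the bond operators `spinBond` (both orderings of the abstract identity).
Mermin–Wagner (1966), p. 1134. [cite: MerminWagnerPRL1966, p. 1134] -/
theorem doubleComm_spinDot (f : Λ → ℂ) (x y : Λ) :
    ((spinDot n x y * (∑ z, f z • siteSpin n z 0) - (∑ z, f z • siteSpin n z 0) * spinDot n x y) *
          (∑ z, f z • siteSpin n z 0) -
      (∑ z, f z • siteSpin n z 0) *
        (spinDot n x y * (∑ z, f z • siteSpin n z 0) - (∑ z, f z • siteSpin n z 0) * spinDot n x y) :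
      Op Λ (n + 1)) =
      (f x - f y) ^ 2 • (spinBond n 1 x y + spinBond n 2 x y) := by
  set C : Op Λ (n + 1) := ∑ z, f z • siteSpin n z 0 with hC
  set D : Op Λ (n + 1) →ₗ[ℂ] Op Λ (n + 1) :=
    LinearMap.mulRight ℂ C - LinearMap.mulLeft ℂ C with hD
  have hDapp : ∀ Z : Op Λ (n + 1), D Z = Z * C - C * Z := fun Z => rfl
  have hxy := doubleComm_sum_siteSpin_mul_siteSpin n f x y
  have hyx := doubleComm_sum_siteSpin_mul_siteSpin n f y x
  rw [← hC, ← hDapp, ← hDapp] at hxy hyx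
  have hdot : spinDot n x y = (1 / 2 : ℂ) • ((∑ a : Fin 3, siteSpin n x a * siteSpin n y a) +
      ∑ a : Fin 3, siteSpin n y a * siteSpin n x a) := by
    simp only [spinDot, spinBond, ← Finset.smul_sum, Finset.sum_add_distrib]
  have hbond : spinBond n 1 x y + spinBond n 2 x y = (1 / 2 : ℂ) •
      ((siteSpin n x 1 * siteSpin n y 1 + siteSpin n x 2 * siteSpin n y 2) +
        (siteSpin n y 1 * siteSpin n x 1 + siteSpin n y 2 * siteSpin n x 2)) := by
    simp only [spinBond, ← smul_add]
    congr 1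
    abel
  rw [← hDapp, ← hDapp, hdot, map_smul, map_smul, map_add, map_add, hxy, hyx, hbond,
    show (f y - f x) ^ 2 = (f x - f y) ^ 2 by ring]
  module

/-- The Mermin–Wagner bond weight `(f_x - f_y)² (B¹_{xy} + B²_{xy})` is symmetric in `x, y`.
[folklore] -/
theorem mwBondWeight_symm (f : Λ → ℂ) (x y : Λ) :
    (f x - f y) ^ 2 • (spinBond n 1 x y + spinBond n 2 x y) =
      (f y - f x) ^ 2 • (spinBond n 1 y x + spinBond n 2 y x) := by
  rw [spinBond_comm n 1 x y, spinBond_comm n 2 x y, show (f y - f x) ^ 2 = (f x - f y) ^ 2 by ring]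

/-- **Mermin–Wagner's double commutator, in real space.** For the Heisenberg Hamiltonian in a field,
`H = J Σ_{⟨x,y⟩} Ŝ_x · Ŝ_y - h Ŝᶻ_tot`, and `C = Σ_z f_z Ŝˣ_z`,
`[C, [H, C]] = C(HC - CH) - (HC - CH)C = -J Σ_{⟨x,y⟩} (f_x - f_y)² (B¹_{xy} + B²_{xy}) + h Σ_x f_x² Ŝᶻ_x`
(`Bᵅ_{xy} = ½(Ŝᵅ_xŜᵅ_y + Ŝᵅ_yŜᵅ_x)`). This is the operator identity behind Mermin–Wagner's bound on
`⟨[[C,H],C†]⟩` (PRL 17 (1966) p. 1134; Gelfert–Nolting (2001) eq. (47)), with the plane wave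
`e^{ik·x}` replaced by a general weight `f`. [cite: MerminWagnerPRL1966, p. 1134] -/
theorem doubleComm_heisenberg_with_field (f : Λ → ℂ) (J h : ℝ) (C H : Op Λ (n + 1))
    (hC : C = ∑ z, f z • siteSpin n z 0)
    (hH : H = heisenbergHamiltonian n G J - (h : ℂ) • totalSpin n 2) :
    C * (H * C - C * H) - (H * C - C * H) * C =
      -((J : ℂ) • ∑ e ∈ G.edgeFinset,
          Sym2.lift ⟨fun x y => (f x - f y) ^ 2 • (spinBond n 1 x y + spinBond n 2 x y),
            mwBondWeight_symm n f⟩ e) +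
        (h : ℂ) • ∑ x, (f x) ^ 2 • siteSpin n x 2 := by
  set D : Op Λ (n + 1) →ₗ[ℂ] Op Λ (n + 1) :=
    LinearMap.mulRight ℂ C - LinearMap.mulLeft ℂ C with hD
  have hDapp : ∀ Z : Op Λ (n + 1), D Z = Z * C - C * Z := fun Z => rfl
  have key : C * (H * C - C * H) - (H * C - C * H) * C = -(D (D H)) := by
    simp only [hDapp]
    noncomm_ring
  rw [key, hH]
  simp only [map_sub, map_smul, heisenbergHamiltonian, map_sum]
  have hedge : ∀ e ∈ G.edgeFinset, D (D (spinDotSym n e)) =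
      Sym2.lift ⟨fun x y => (f x - f y) ^ 2 • (spinBond n 1 x y + spinBond n 2 x y),
        mwBondWeight_symm n f⟩ e := by
    intro e _
    induction e using Sym2.ind with
    | h x y =>
      rw [spinDotSym_mk, Sym2.lift_mk, hDapp, hDapp, hC]
      exact doubleComm_spinDot n f x y
  have hfield : D (D (totalSpin n 2)) = ∑ x, (f x) ^ 2 • siteSpin n x 2 := by
    rw [totalSpin, map_sum, map_sum]
    refine Finset.sum_congr rfl fun x _ => ?_
    rw [hDapp, hDapp, hC]
    exact doubleComm_siteSpin_two n f x
  rw [Finset.sum_congr rfl hedge, hfield, neg_sub, sub_eq_neg_add]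

end Hamiltonian

/-! ### Bounds on Gibbs expectations from operator inequalities -/

section GibbsBounds

variable {m : Type*} [Fintype m] [DecidableEq m]

/-- `Re ⟨X⟩_β ≤ Re c` whenever `c·1 - X ≥ 0` (positivity and normalisation of the Gibbs state of a
Hermitian Hamiltonian). Bratteli–Robinson II §5.3.1. [folklore] -/
theorem re_gibbsState_le_of_posSemidef {H : Matrix m m ℂ} (hH : H.IsHermitian) [Nonempty m]
    (β : ℝ) {X : Matrix m m ℂ} {c : ℂ} (h : (c • (1 : Matrix m m ℂ) - X).PosSemidef) :
    (gibbsState β H X).re ≤ c.re := by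
  have hZ : partitionFn β H ≠ 0 := (partitionFn_pos β hH).ne'
  have h0 := gibbsState_nonneg_of_posSemidef β hH h
  rw [map_sub, LinearMap.map_smul, gibbsState_one β H hZ, smul_eq_mul, mul_one] at h0
  obtain ⟨hre, -⟩ := Complex.nonneg_iff.mp h0
  rw [Complex.sub_re] at hre
  linarith

/-- `-Re c ≤ Re ⟨X⟩_β` whenever `c·1 + X ≥ 0`. Bratteli–Robinson II §5.3.1. [folklore] -/
theorem neg_re_le_re_gibbsState_of_posSemidef {H : Matrix m m ℂ} (hH : H.IsHermitian) [Nonempty m]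
    (β : ℝ) {X : Matrix m m ℂ} {c : ℂ} (h : (c • (1 : Matrix m m ℂ) + X).PosSemidef) :
    -c.re ≤ (gibbsState β H X).re := by
  have hZ : partitionFn β H ≠ 0 := (partitionFn_pos β hH).ne'
  have h0 := gibbsState_nonneg_of_posSemidef β hH h
  rw [map_add, LinearMap.map_smul, gibbsState_one β H hZ, smul_eq_mul, mul_one] at h0
  obtain ⟨hre, -⟩ := Complex.nonneg_iff.mp h0
  rw [Complex.add_re] at hre
  linarith

/-- `|Re ⟨X⟩_β| ≤ Re c` whenever `c·1 ∓ X ≥ 0`. Bratteli–Robinson II §5.3.1. [folklore] -/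
theorem abs_re_gibbsState_le_of_posSemidef {H : Matrix m m ℂ} (hH : H.IsHermitian) [Nonempty m]
    (β : ℝ) {X : Matrix m m ℂ} {c : ℂ} (hsub : (c • (1 : Matrix m m ℂ) - X).PosSemidef)
    (hadd : (c • (1 : Matrix m m ℂ) + X).PosSemidef) :
    |(gibbsState β H X).re| ≤ c.re :=
  abs_le.2 ⟨neg_re_le_re_gibbsState_of_posSemidef hH β hadd,
    re_gibbsState_le_of_posSemidef hH β hsub⟩

/-- `0 ≤ Re ⟨A²⟩_β` for Hermitian `A` (`A² = AᴴA ≥ 0`). Bratteli–Robinson II §5.3.1. [folklore] -/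
theorem re_gibbsState_mul_self_nonneg_of_isHermitian {H : Matrix m m ℂ} (hH : H.IsHermitian) (β : ℝ)
    {A : Matrix m m ℂ} (hA : A.IsHermitian) : 0 ≤ (gibbsState β H (A * A)).re := by
  have h0 : (A * A).PosSemidef := by
    simpa only [hA.eq] using posSemidef_conjTranspose_mul_self A
  obtain ⟨hre, -⟩ := Complex.nonneg_iff.mp (gibbsState_nonneg_of_posSemidef β hH h0)
  simpa using hre

end GibbsBounds

/-! ### Loewner bounds for the bond operators (`-S² ≤ Bᵅ_{xy} ≤ S²`)

The one-site bounds `S·1 ∓ Ŝᵅ_x ≥ 0`, `S²·1 - (Ŝᵅ_x)² ≥ 0` are `posSemidef_smul_one_sub_siteSpin`,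
`posSemidef_smul_one_add_siteSpin`, `posSemidef_sq_smul_one_sub_siteSpin_sq` of `XYOrderDischarges.lean`. -/

section SpinBounds

variable {Λ : Type*} [Fintype Λ] [DecidableEq Λ] (n : ℕ)

/-- **`-S² ≤ Bᵅ_{xy} ≤ S²`**, upper half: `S²·1 - ½(Ŝᵅ_xŜᵅ_y + Ŝᵅ_yŜᵅ_x) ≥ 0`, from the identity
`S²·1 - ½(AB + BA) = ½[(A - B)ᴴ(A - B) + (S²·1 - A²) + (S²·1 - B²)]` for Hermitian `A`, `B`.
[folklore] -/
theorem posSemidef_sq_smul_one_sub_spinBond (a : Fin 3) (x y : Λ) :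
    (((n : ℂ) / 2) ^ 2 • (1 : Op Λ (n + 1)) - spinBond n a x y).PosSemidef := by
  set A : Op Λ (n + 1) := siteSpin n x a with hA
  set B : Op Λ (n + 1) := siteSpin n y a with hB
  have hAh : Aᴴ = A := (siteSpin_isHermitian n x a).eq
  have hBh : Bᴴ = B := (siteSpin_isHermitian n y a).eq
  have hhalf : (0 : ℂ) ≤ 1 / 2 := by
    rw [show (1 / 2 : ℂ) = ((1 / 2 : ℝ) : ℂ) by push_cast; ring]
    exact Complex.zero_le_real.mpr (by norm_num)
  have key : ((n : ℂ) / 2) ^ 2 • (1 : Op Λ (n + 1)) - spinBond n a x y =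
      (1 / 2 : ℂ) • ((A - B)ᴴ * (A - B) +
        ((((n : ℂ) / 2) ^ 2 • (1 : Op Λ (n + 1)) - A * A) +
          (((n : ℂ) / 2) ^ 2 • (1 : Op Λ (n + 1)) - B * B))) := by
    rw [conjTranspose_sub, hAh, hBh, spinBond, ← hA, ← hB]
    simp only [sub_mul, mul_sub, smul_add, smul_sub]
    module
  rw [key]
  exact ((posSemidef_conjTranspose_mul_self _).add
    ((posSemidef_sq_smul_one_sub_siteSpin_sq n x a).add
      (posSemidef_sq_smul_one_sub_siteSpin_sq n y a))).smul hhalf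

/-- **`-S² ≤ Bᵅ_{xy} ≤ S²`**, lower half: `S²·1 + ½(Ŝᵅ_xŜᵅ_y + Ŝᵅ_yŜᵅ_x) ≥ 0`
(`S²·1 + ½(AB + BA) = ½[(A + B)ᴴ(A + B) + (S²·1 - A²) + (S²·1 - B²)]`). [folklore] -/
theorem posSemidef_sq_smul_one_add_spinBond (a : Fin 3) (x y : Λ) :
    (((n : ℂ) / 2) ^ 2 • (1 : Op Λ (n + 1)) + spinBond n a x y).PosSemidef := by
  set A : Op Λ (n + 1) := siteSpin n x a with hA
  set B : Op Λ (n + 1) := siteSpin n y a with hB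
  have hAh : Aᴴ = A := (siteSpin_isHermitian n x a).eq
  have hBh : Bᴴ = B := (siteSpin_isHermitian n y a).eq
  have hhalf : (0 : ℂ) ≤ 1 / 2 := by
    rw [show (1 / 2 : ℂ) = ((1 / 2 : ℝ) : ℂ) by push_cast; ring]
    exact Complex.zero_le_real.mpr (by norm_num)
  have key : ((n : ℂ) / 2) ^ 2 • (1 : Op Λ (n + 1)) + spinBond n a x y =
      (1 / 2 : ℂ) • ((A + B)ᴴ * (A + B) +
        ((((n : ℂ) / 2) ^ 2 • (1 : Op Λ (n + 1)) - A * A) +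
          (((n : ℂ) / 2) ^ 2 • (1 : Op Λ (n + 1)) - B * B))) := by
    rw [conjTranspose_add, hAh, hBh, spinBond, ← hA, ← hB]
    simp only [add_mul, mul_add, smul_add, smul_sub]
    module
  rw [key]
  exact ((posSemidef_conjTranspose_mul_self _).add
    ((posSemidef_sq_smul_one_sub_siteSpin_sq n x a).add
      (posSemidef_sq_smul_one_sub_siteSpin_sq n y a))).smul hhalf

end SpinBounds


/-! ### The local Mermin–Wagner bound from Bogoliubov's inequality -/

section LocalBound

variable {Λ : Type*} [Fintype Λ] [DecidableEq Λ] (n : ℕ) (G : SimpleGraph Λ) [DecidableRel G.Adj]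

/-- The Heisenberg Hamiltonian in a field `H = J Σ Ŝ_x·Ŝ_y - h Ŝᶻ_tot` is Hermitian.
Mermin–Wagner (1966), eq. (1). [cite: MerminWagnerPRL1966, eq. (1)] -/
theorem heisenbergHamiltonian_sub_field_isHermitian (J h : ℝ) :
    (heisenbergHamiltonian n G J - (h : ℂ) • totalSpin n 2 : Op Λ (n + 1)).IsHermitian := by
  refine (heisenbergHamiltonian_isHermitian n G J).sub (IsHermitian.smul ?_ ?_)
  · exact totalSpin_isHermitian n 2
  · rw [isSelfAdjoint_iff, Complex.star_def, conj_ofReal]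

/-- `C = Σ_z f_z Ŝˣ_z` is Hermitian for real weights `f`. [folklore] -/
theorem sum_smul_siteSpin_isHermitian (f : Λ → ℝ) (a : Fin 3) :
    (∑ z, ((f z : ℝ) : ℂ) • siteSpin n z a : Op Λ (n + 1)).IsHermitian := by
  rw [IsHermitian, conjTranspose_sum]
  refine Finset.sum_congr rfl fun z _ => ?_
  rw [conjTranspose_smul, (siteSpin_isHermitian n z a).eq, Complex.star_def, conj_ofReal]

/-- `|Re ⟨(f_x - f_y)² (B¹_{xy} + B²_{xy})⟩| ≤ 2S² (f_x - f_y)²` per bond (`-S² ≤ Bᵅ_{xy} ≤ S²`).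
Mermin–Wagner (1966), p. 1134 (bound on the double commutator). [cite: MerminWagnerPRL1966, p. 1134] -/
theorem abs_re_gibbsState_mwBondWeight_le {H : Op Λ (n + 1)} (hH : H.IsHermitian) (β : ℝ)
    (f : Λ → ℝ) (e : Sym2 Λ) :
    |(gibbsState β H (Sym2.lift ⟨fun x y => (((f x : ℝ) : ℂ) - f y) ^ 2 •
        (spinBond n 1 x y + spinBond n 2 x y), mwBondWeight_symm n fun z => (f z : ℂ)⟩ e)).re| ≤
      2 * ((n : ℝ) / 2) ^ 2 * Sym2.lift ⟨fun x y => (f x - f y) ^ 2, fun x y => by ring⟩ e := by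
  induction e using Sym2.ind with
  | h x y =>
    rw [Sym2.lift_mk, Sym2.lift_mk, LinearMap.map_smul, smul_eq_mul,
      show (((f x : ℝ) : ℂ) - f y) ^ 2 = (((f x - f y) ^ 2 : ℝ) : ℂ) by push_cast; ring,
      Complex.re_ofReal_mul, abs_mul, abs_of_nonneg (sq_nonneg _), mul_comm]
    refine mul_le_mul_of_nonneg_right ?_ (sq_nonneg _)
    have hS2 : (((n : ℂ) / 2) ^ 2).re = ((n : ℝ) / 2) ^ 2 := by
      rw [show ((n : ℂ) / 2) ^ 2 = ((((n : ℝ) / 2) ^ 2 : ℝ) : ℂ) by push_cast; ring,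
        Complex.ofReal_re]
    have h1 := abs_re_gibbsState_le_of_posSemidef hH β
      (posSemidef_sq_smul_one_sub_spinBond n 1 x y) (posSemidef_sq_smul_one_add_spinBond n 1 x y)
    have h2 := abs_re_gibbsState_le_of_posSemidef hH β
      (posSemidef_sq_smul_one_sub_spinBond n 2 x y) (posSemidef_sq_smul_one_add_spinBond n 2 x y)
    rw [hS2] at h1 h2
    rw [map_add, Complex.add_re]
    calc |(gibbsState β H (spinBond n 1 x y)).re + (gibbsState β H (spinBond n 2 x y)).re|
        ≤ |(gibbsState β H (spinBond n 1 x y)).re| + |(gibbsState β H (spinBond n 2 x y)).re| :=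
          abs_add_le _ _
      _ ≤ ((n : ℝ) / 2) ^ 2 + ((n : ℝ) / 2) ^ 2 := add_le_add h1 h2
      _ = 2 * ((n : ℝ) / 2) ^ 2 := by ring

/-- `|Re ⟨f_x² Ŝᶻ_x⟩| ≤ S f_x²` per site (`-S ≤ Ŝᶻ_x ≤ S`). Mermin–Wagner (1966), p. 1134.
[cite: MerminWagnerPRL1966, p. 1134] -/
theorem abs_re_gibbsState_sq_smul_siteSpin_le {H : Op Λ (n + 1)} (hH : H.IsHermitian) (β : ℝ)
    (f : Λ → ℝ) (x : Λ) :
    |(gibbsState β H ((((f x : ℝ) : ℂ)) ^ 2 • siteSpin n x 2)).re| ≤ (n : ℝ) / 2 * (f x) ^ 2 := by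
  rw [LinearMap.map_smul, smul_eq_mul, show (((f x : ℝ) : ℂ)) ^ 2 = (((f x) ^ 2 : ℝ) : ℂ) by push_cast; ring,
    Complex.re_ofReal_mul, abs_mul, abs_of_nonneg (sq_nonneg _), mul_comm]
  refine mul_le_mul_of_nonneg_right ?_ (sq_nonneg _)
  have hS : (((n : ℂ) / 2)).re = (n : ℝ) / 2 := by
    rw [show ((n : ℂ) / 2) = ((((n : ℝ) / 2) : ℝ) : ℂ) by push_cast; ring, Complex.ofReal_re]
  have h1 := abs_re_gibbsState_le_of_posSemidef hH β
    (posSemidef_smul_one_sub_siteSpin n x 2) (posSemidef_smul_one_add_siteSpin n x 2)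
  rwa [hS] at h1

/-- **The local Mermin–Wagner bound (any finite graph, any real weight).** For the spin-`S` Heisenberg
model in a field, `H = J Σ_{⟨x,y⟩} Ŝ_x·Ŝ_y - h Ŝᶻ_tot`, at inverse temperature `β ≥ 0`, and every
`f : Λ → ℝ` with `f(o) = 1`:
`(Re ⟨Ŝᶻ_o⟩)² ≤ β S² (2|J| S² Σ_{⟨x,y⟩} (f_x - f_y)² + |h| S Σ_x f_x²)` (`S = n/2`).
This is Bogoliubov's inequality `|⟨[C,A]⟩|² ≤ β ⟨A²⟩ ⟨[C,[H,C]]⟩` with `C = Σ_x f_x Ŝˣ_x`,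
`A = Ŝʸ_o` (so `[C, A] = i f_o Ŝᶻ_o`), together with Mermin–Wagner's bounds on `⟨A²⟩` and on the
double commutator — steps (c)–(d) of the printed proof (PRL 17 (1966) pp. 1133–1134; Gelfert–Nolting
(2001) eqs. (43)–(48)) with the plane wave replaced by a real-space weight `f`.
[cite: MerminWagnerPRL1966, pp. 1133–1134] [cite: GelfertNolting2001, §3 eqs. (43)–(48)] -/
theorem sq_re_gibbsState_siteSpin_le (J h : ℝ) {β : ℝ} (hβ : 0 ≤ β) (f : Λ → ℝ) (o : Λ)
    (hfo : f o = 1) :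
    (gibbsState β (heisenbergHamiltonian n G J - (h : ℂ) • totalSpin n 2) (siteSpin n o 2)).re ^ 2 ≤
      β * ((n : ℝ) / 2) ^ 2 *
        (|J| * (2 * ((n : ℝ) / 2) ^ 2) *
            ∑ e ∈ G.edgeFinset, Sym2.lift ⟨fun x y => (f x - f y) ^ 2, fun x y => by ring⟩ e +
          |h| * ((n : ℝ) / 2) * ∑ x, (f x) ^ 2) := by
  set H : Op Λ (n + 1) := heisenbergHamiltonian n G J - (h : ℂ) • totalSpin n 2 with hHdef
  set C : Op Λ (n + 1) := ∑ z, ((f z : ℝ) : ℂ) • siteSpin n z 0 with hCdef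
  set A : Op Λ (n + 1) := siteSpin n o 1 with hAdef
  set S : ℝ := (n : ℝ) / 2 with hSdef
  set E : ℝ := ∑ e ∈ G.edgeFinset, Sym2.lift ⟨fun x y => (f x - f y) ^ 2, fun x y => by ring⟩ e
    with hEdef
  set F : ℝ := ∑ x, (f x) ^ 2 with hFdef
  have hH : H.IsHermitian := heisenbergHamiltonian_sub_field_isHermitian n G J h
  have hA : A.IsHermitian := siteSpin_isHermitian n o 1
  have hC : C.IsHermitian := sum_smul_siteSpin_isHermitian n f 0
  haveI : Nonempty (TensorIndex Λ (n + 1)) := ⟨fun _ => 0⟩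
  -- Bogoliubov's inequality
  have hB := bogoliubov_inequality hH hA hC hβ
  -- the left-hand side: `CA - AC = i Ŝᶻ_o`
  have hCA : C * A - A * C = I • siteSpin n o 2 := by
    have h1 := siteSpin_one_comm_sub n (fun z => ((f z : ℝ) : ℂ)) o
    rw [← neg_sub, h1, hfo]
    simp
  have hLHS : (gibbsState β H (siteSpin n o 2)).re ^ 2 ≤ ‖gibbsState β H (C * A - A * C)‖ ^ 2 := by
    rw [hCA, LinearMap.map_smul, smul_eq_mul, norm_mul, Complex.norm_I, one_mul]
    have h1 := Complex.abs_re_le_norm (gibbsState β H (siteSpin n o 2))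
    exact sq_le_sq' (by linarith [neg_abs_le (gibbsState β H (siteSpin n o 2)).re])
      ((le_abs_self _).trans h1)
  -- `0 ≤ ⟨A²⟩ ≤ S²`
  have hS2re : (((n : ℂ) / 2) ^ 2).re = S ^ 2 := by
    rw [show ((n : ℂ) / 2) ^ 2 = ((((n : ℝ) / 2) ^ 2 : ℝ) : ℂ) by push_cast; ring, Complex.ofReal_re]
  have hA2 : (gibbsState β H (A * A)).re ≤ S ^ 2 := by
    have := re_gibbsState_le_of_posSemidef hH β (posSemidef_sq_smul_one_sub_siteSpin_sq n o 1)
    rwa [hS2re] at this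
  -- the double commutator
  have hDC := doubleComm_heisenberg_with_field n G (fun z => ((f z : ℝ) : ℂ)) J h C H hCdef hHdef
  have hDC0 : 0 ≤ (gibbsState β H (C * (H * C - C * H) - (H * C - C * H) * C)).re :=
    hH.re_gibbsState_doubleComm_nonneg hC hβ
  have hDCle : (gibbsState β H (C * (H * C - C * H) - (H * C - C * H) * C)).re ≤
      |J| * (2 * S ^ 2) * E + |h| * S * F := by
    rw [hDC, map_add, map_neg, LinearMap.map_smul, LinearMap.map_smul, map_sum, map_sum,
      Complex.add_re, Complex.neg_re, smul_eq_mul, smul_eq_mul, Complex.re_ofReal_mul,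
      Complex.re_ofReal_mul, Complex.re_sum, Complex.re_sum]
    refine add_le_add ?_ ?_
    · calc -(J * ∑ e ∈ G.edgeFinset, (gibbsState β H (Sym2.lift ⟨fun x y =>
            (((f x : ℝ) : ℂ) - f y) ^ 2 • (spinBond n 1 x y + spinBond n 2 x y),
              mwBondWeight_symm n fun z => (f z : ℂ)⟩ e)).re)
          ≤ |J| * ∑ e ∈ G.edgeFinset, |(gibbsState β H (Sym2.lift ⟨fun x y =>
            (((f x : ℝ) : ℂ) - f y) ^ 2 • (spinBond n 1 x y + spinBond n 2 x y),
              mwBondWeight_symm n fun z => (f z : ℂ)⟩ e)).re| := by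
            refine (neg_le_abs _).trans ?_
            rw [abs_mul]
            exact mul_le_mul_of_nonneg_left (Finset.abs_sum_le_sum_abs _ _) (abs_nonneg _)
        _ ≤ |J| * ∑ e ∈ G.edgeFinset, 2 * S ^ 2 *
            Sym2.lift ⟨fun x y => (f x - f y) ^ 2, fun x y => by ring⟩ e :=
            mul_le_mul_of_nonneg_left (Finset.sum_le_sum fun e _ =>
              abs_re_gibbsState_mwBondWeight_le n hH β f e) (abs_nonneg _)
        _ = |J| * (2 * S ^ 2) * E := by rw [← Finset.mul_sum, hEdef]; ring
    · calc h * ∑ x, (gibbsState β H ((((f x : ℝ) : ℂ)) ^ 2 • siteSpin n x 2)).re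
          ≤ |h| * ∑ x, |(gibbsState β H ((((f x : ℝ) : ℂ)) ^ 2 • siteSpin n x 2)).re| := by
            refine (le_abs_self _).trans ?_
            rw [abs_mul]
            exact mul_le_mul_of_nonneg_left (Finset.abs_sum_le_sum_abs _ _) (abs_nonneg _)
        _ ≤ |h| * ∑ x, S * (f x) ^ 2 :=
            mul_le_mul_of_nonneg_left (Finset.sum_le_sum fun x _ =>
              abs_re_gibbsState_sq_smul_siteSpin_le n hH β f x) (abs_nonneg _)
        _ = |h| * S * F := by rw [← Finset.mul_sum, hFdef]; ring
  -- assemble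
  have hSβ : 0 ≤ β * S ^ 2 := mul_nonneg hβ (sq_nonneg _)
  calc (gibbsState β H (siteSpin n o 2)).re ^ 2
      ≤ ‖gibbsState β H (C * A - A * C)‖ ^ 2 := hLHS
    _ ≤ β * (gibbsState β H (A * A)).re *
          (gibbsState β H (C * (H * C - C * H) - (H * C - C * H) * C)).re := hB
    _ ≤ β * S ^ 2 * (gibbsState β H (C * (H * C - C * H) - (H * C - C * H) * C)).re := by
        refine mul_le_mul_of_nonneg_right (mul_le_mul_of_nonneg_left hA2 hβ) hDC0
    _ ≤ β * S ^ 2 * (|J| * (2 * S ^ 2) * E + |h| * S * F) :=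
        mul_le_mul_of_nonneg_left hDCle hSβ

end LocalBound

/-! ### Sums over edges versus ordered pairs -/

section Edges

variable {V : Type*} [Fintype V] [DecidableEq V]

/-- **An edge sum is dominated by the ordered-pair sum** for a symmetric nonnegative weight:
`Σ_{e={x,y}} w(x,y) ≤ Σ_x Σ_y [x ∼ y] w(x,y)` (each edge carries two ordered pairs; one suffices).
[folklore] -/
theorem sum_edgeFinset_lift_le_sum_sum_ite (G : SimpleGraph V) [DecidableRel G.Adj] (w : V → V → ℝ)
    (hw : ∀ x y, w x y = w y x) (hw0 : ∀ x y, 0 ≤ w x y) :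
    ∑ e ∈ G.edgeFinset, Sym2.lift ⟨w, hw⟩ e ≤ ∑ x, ∑ y, if G.Adj x y then w x y else 0 := by
  classical
  set g : V × V → ℝ := fun p => if G.Adj p.1 p.2 then w p.1 p.2 else 0 with hg
  have hout : ∀ e : Sym2 V, s(e.out.1, e.out.2) = e := fun e => by rw [Sym2.mk, e.out_eq]
  have hinj : Set.InjOn (fun e : Sym2 V => e.out) (G.edgeFinset : Set (Sym2 V)) := by
    intro a _ b _ hab
    rw [← hout a, ← hout b]
    simp only at hab
    rw [hab]
  have hval : ∀ e ∈ G.edgeFinset, Sym2.lift ⟨w, hw⟩ e = g e.out := by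
    intro e he
    have hadj : G.Adj e.out.1 e.out.2 := by
      rw [← SimpleGraph.mem_edgeSet, hout e]
      exact SimpleGraph.mem_edgeFinset.1 he
    conv_lhs => rw [← hout e]
    rw [hg, Sym2.lift_mk]
    simp only [if_pos hadj]
  calc ∑ e ∈ G.edgeFinset, Sym2.lift ⟨w, hw⟩ e
      = ∑ e ∈ G.edgeFinset, g e.out := Finset.sum_congr rfl hval
    _ = ∑ p ∈ G.edgeFinset.image (fun e : Sym2 V => e.out), g p :=
        (Finset.sum_image hinj).symm
    _ ≤ ∑ p ∈ (univ : Finset (V × V)), g p := by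
        refine Finset.sum_le_sum_of_subset_of_nonneg (Finset.subset_univ _) fun p _ _ => ?_
        simp only [hg]
        split_ifs
        · exact hw0 _ _
        · exact le_rfl
    _ = ∑ x, ∑ y, if G.Adj x y then w x y else 0 := by
        rw [← Finset.univ_product_univ, Finset.sum_product]

end Edges

/-! ### The Dirichlet energy of a radial test function on the torus

The torus-metric facts are those of `LatticeToriProofs.lean` (`torusDist_le_of_adj` of
`TorusTestPotential.lean`, `card_filter_adj_le`, `card_filter_torusDist_eq_le`, `sum_adj_le_of_le_add`,
`sum_radial_le`). -/

section Energy

variable {d L : ℕ} [NeZero L]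

omit [NeZero L] in
/-- One step of a profile: if `|a - b| ≤ 1` then `(g a - g b)² ≤ (g a - g (a+1))² + (g b - g (b+1))²`.
[folklore] -/
theorem sq_sub_le_of_step (g : ℕ → ℝ) {a b : ℕ} (h1 : b ≤ a + 1) (h2 : a ≤ b + 1) :
    (g a - g b) ^ 2 ≤ (g a - g (a + 1)) ^ 2 + (g b - g (b + 1)) ^ 2 := by
  have hsq1 : 0 ≤ (g a - g (a + 1)) ^ 2 := sq_nonneg _
  have hsq2 : 0 ≤ (g b - g (b + 1)) ^ 2 := sq_nonneg _
  rcases Nat.lt_or_ge a b with hab | hab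
  · have hb : b = a + 1 := by omega
    subst hb
    linarith
  · rcases eq_or_lt_of_le hab with hab' | hab'
    · subst hab'
      simp only [sub_self, ne_eq, OfNat.ofNat_ne_zero, not_false_eq_true, zero_pow]
      linarith
    · have ha : a = b + 1 := by omega
      subst ha
      rw [show (g (b + 1) - g b) ^ 2 = (g b - g (b + 1)) ^ 2 by ring]
      linarith

/-- **Dirichlet energy of a radial function on the torus.** For every profile `g : ℕ → ℝ` and
centre `o`, the energy of `x ↦ g(dist(x, o))` over the nearest-neighbour bonds of `(ℤ/Lℤ)^d` is at
most `4d Σ_u (g(dist(u,o)) - g(dist(u,o) + 1))²` (each bond changes the distance by at most one, at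
most `2d` neighbours). [folklore] -/
theorem sum_edgeFinset_radial_sq_le (g : ℕ → ℝ) (o : TorusSite d L) :
    ∑ e ∈ (torusGraph d L).edgeFinset, Sym2.lift ⟨fun x y =>
        (g (torusDist x o) - g (torusDist y o)) ^ 2, fun x y => by ring⟩ e ≤
      4 * d * ∑ u : TorusSite d L, (g (torusDist u o) - g (torusDist u o + 1)) ^ 2 := by
  have h1 := sum_edgeFinset_lift_le_sum_sum_ite (torusGraph d L)
    (fun x y => (g (torusDist x o) - g (torusDist y o)) ^ 2) (fun x y => by ring)
    (fun x y => sq_nonneg _)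
  have h2 := sum_adj_le_of_le_add (fun x y => (g (torusDist x o) - g (torusDist y o)) ^ 2)
    (fun u => (g (torusDist u o) - g (torusDist u o + 1)) ^ 2) (fun u => sq_nonneg _)
    (fun u v huv => by
      have hstep := torusDist_le_of_adj L huv o
      exact sq_sub_le_of_step g hstep.2 hstep.1)
    card_filter_adj_le
  refine h1.trans (h2.trans (le_of_eq ?_))
  ring

/-- **Shell summation** of a nonnegative radial quantity on `(ℤ/Lℤ)^d`, `d ∈ {1, 2}`, supported in
radius `< R`: `Σ_u Φ(dist(u,o)) ≤ Σ_{r<R} 4(2r+1) Φ(r)`. [folklore] -/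
theorem sum_radial_le_sum_range (hd1 : 1 ≤ d) (hd2 : d ≤ 2) {Φ : ℕ → ℝ} (hΦ : ∀ r, 0 ≤ Φ r) {R : ℕ}
    (hR : ∀ r, R ≤ r → Φ r = 0) (o : TorusSite d L) :
    ∑ u : TorusSite d L, Φ (torusDist u o) ≤ ∑ r ∈ range R, 4 * (2 * (r : ℝ) + 1) * Φ r := by
  have h1 := sum_radial_le Φ hΦ o (card_filter_torusDist_eq_le hd1 o) fun u => torusDist_lt u o
  have hcoef : ∀ r : ℕ, ((d * (2 * (2 * r + 1) ^ (d - 1)) : ℕ) : ℝ) ≤ 4 * (2 * (r : ℝ) + 1) := by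
    intro r
    have h : d * (2 * (2 * r + 1) ^ (d - 1)) ≤ 4 * (2 * r + 1) := by
      interval_cases d <;> simp <;> omega
    exact_mod_cast h
  have h2 : ∑ r ∈ range L, ((d * (2 * (2 * r + 1) ^ (d - 1)) : ℕ) : ℝ) * Φ r ≤
      ∑ r ∈ range L, 4 * (2 * (r : ℝ) + 1) * Φ r :=
    sum_le_sum fun r _ => mul_le_mul_of_nonneg_right (hcoef r) (hΦ r)
  have h3 : ∑ r ∈ range L, 4 * (2 * (r : ℝ) + 1) * Φ r ≤ ∑ r ∈ range R, 4 * (2 * (r : ℝ) + 1) * Φ r := by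
    rw [← Finset.sum_filter_of_ne (s := range L) (p := fun r => r < R) (fun r _ hr => by
      by_contra hlt
      exact hr (by rw [hR r (not_lt.1 hlt), mul_zero]))]
    exact Finset.sum_le_sum_of_subset_of_nonneg (fun r hr => mem_range.2 (mem_filter.1 hr).2)
      fun r _ _ => by have := hΦ r; positivity
  exact h1.trans (h2.trans h3)

omit [NeZero L] in
/-- `Σ_{r<R} (2r+1) = R²`. [folklore] -/
theorem sum_range_two_mul_cast_add_one (R : ℕ) : ∑ r ∈ range R, (2 * (r : ℝ) + 1) = (R : ℝ) ^ 2 := by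
  induction R with
  | zero => simp
  | succ k ih => rw [sum_range_succ, ih]; push_cast; ring

end Energy

/-! ### The harmonic (logarithmic) profile -/

section Profile

/-- The harmonic numbers `H_R = Σ_{k<R} 1/(k+1)` are at least `1` for `R ≥ 1`. [folklore] -/
theorem one_le_sum_range_one_div_succ {R : ℕ} (hR : 1 ≤ R) :
    (1 : ℝ) ≤ ∑ k ∈ range R, (1 : ℝ) / (k + 1) := by
  calc (1 : ℝ) = ∑ k ∈ range 1, (1 : ℝ) / (k + 1) := by simp
    _ ≤ ∑ k ∈ range R, (1 : ℝ) / (k + 1) :=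
        Finset.sum_le_sum_of_subset_of_nonneg (range_subset_range.2 hR) fun k _ _ => by positivity

/-- The profile `g(r) = (Σ_{r ≤ k < R} 1/(k+1)) / H_R` equals `1` at `r = 0` (`R ≥ 1`). [folklore] -/
theorem harmonicProfile_zero {R : ℕ} (hR : 1 ≤ R) :
    (∑ k ∈ Ico 0 R, (1 : ℝ) / (k + 1)) / (∑ k ∈ range R, (1 : ℝ) / (k + 1)) = 1 := by
  rw [← Finset.range_eq_Ico]
  exact div_self (by linarith [one_le_sum_range_one_div_succ hR])

/-- The profile vanishes from `r = R` on. [folklore] -/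
theorem harmonicProfile_eq_zero {R r : ℕ} (hr : R ≤ r) :
    (∑ k ∈ Ico r R, (1 : ℝ) / (k + 1)) / (∑ k ∈ range R, (1 : ℝ) / (k + 1)) = 0 := by
  rw [Finset.Ico_eq_empty_of_le hr, sum_empty, zero_div]

/-- `0 ≤ g(r)`. [folklore] -/
theorem harmonicProfile_nonneg (R r : ℕ) :
    0 ≤ (∑ k ∈ Ico r R, (1 : ℝ) / (k + 1)) / (∑ k ∈ range R, (1 : ℝ) / (k + 1)) :=
  div_nonneg (sum_nonneg fun k _ => by positivity) (sum_nonneg fun k _ => by positivity)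

/-- `g(r) ≤ 1`. [folklore] -/
theorem harmonicProfile_le_one (R r : ℕ) :
    (∑ k ∈ Ico r R, (1 : ℝ) / (k + 1)) / (∑ k ∈ range R, (1 : ℝ) / (k + 1)) ≤ 1 := by
  refine div_le_one_of_le₀ ?_ (sum_nonneg fun k _ => by positivity)
  rw [Finset.range_eq_Ico]
  exact Finset.sum_le_sum_of_subset_of_nonneg (Finset.Ico_subset_Ico_left (Nat.zero_le r))
    fun k _ _ => by positivity

/-- **The increments of the harmonic profile**: `g(r) - g(r+1) = 1/((r+1) H_R)` for `r < R` and `0`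
otherwise. [folklore] -/
theorem harmonicProfile_sub_succ (R r : ℕ) :
    (∑ k ∈ Ico r R, (1 : ℝ) / (k + 1)) / (∑ k ∈ range R, (1 : ℝ) / (k + 1)) -
        (∑ k ∈ Ico (r + 1) R, (1 : ℝ) / (k + 1)) / (∑ k ∈ range R, (1 : ℝ) / (k + 1)) =
      if r < R then 1 / ((r + 1) * ∑ k ∈ range R, (1 : ℝ) / (k + 1)) else 0 := by
  split_ifs with hr
  · rw [Finset.sum_eq_sum_Ico_succ_bot hr, ← sub_div, add_sub_cancel_right, div_div]
  · rw [Finset.Ico_eq_empty_of_le (not_lt.1 hr), Finset.Ico_eq_empty_of_le (by omega), sum_empty,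
      sub_self]

/-- **The shell-weighted energy of the harmonic profile is `O(1/H_R)`**:
`Σ_{r<R} 4(2r+1) (g(r) - g(r+1))² ≤ 8 / H_R`. This is the discrete form of the vanishing capacity of
a point in two dimensions (`∫ |∇ log|² ~ log R` against `(log R)²`). [folklore] -/
theorem sum_shell_harmonicProfile_sq_le {R : ℕ} (hR : 1 ≤ R) :
    ∑ r ∈ range R, 4 * (2 * (r : ℝ) + 1) *
        ((∑ k ∈ Ico r R, (1 : ℝ) / (k + 1)) / (∑ k ∈ range R, (1 : ℝ) / (k + 1)) -
          (∑ k ∈ Ico (r + 1) R, (1 : ℝ) / (k + 1)) / (∑ k ∈ range R, (1 : ℝ) / (k + 1))) ^ 2 ≤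
      8 / ∑ k ∈ range R, (1 : ℝ) / (k + 1) := by
  set H : ℝ := ∑ k ∈ range R, (1 : ℝ) / (k + 1) with hH
  have hH1 : 1 ≤ H := one_le_sum_range_one_div_succ hR
  have hH0 : 0 < H := by linarith
  have hterm : ∀ r ∈ range R, 4 * (2 * (r : ℝ) + 1) *
      ((∑ k ∈ Ico r R, (1 : ℝ) / (k + 1)) / H - (∑ k ∈ Ico (r + 1) R, (1 : ℝ) / (k + 1)) / H) ^ 2 ≤
        8 / H ^ 2 * (1 / (r + 1)) := by
    intro r hr
    rw [harmonicProfile_sub_succ, if_pos (mem_range.1 hr)]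
    have hr0 : (0 : ℝ) < r + 1 := by positivity
    rw [div_pow, one_pow, mul_pow, show 4 * (2 * (r : ℝ) + 1) * (1 / ((r + 1) ^ 2 * H ^ 2)) =
      (4 * (2 * (r : ℝ) + 1) / (r + 1)) / H ^ 2 * (1 / (r + 1)) by field_simp]
    refine mul_le_mul_of_nonneg_right (div_le_div_of_nonneg_right ?_ (by positivity)) (by positivity)
    rw [div_le_iff₀ hr0]
    linarith
  calc _ ≤ ∑ r ∈ range R, 8 / H ^ 2 * (1 / ((r : ℝ) + 1)) := sum_le_sum hterm
    _ = 8 / H ^ 2 * H := by rw [← Finset.mul_sum]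
    _ = 8 / H := by field_simp

/-- The harmonic numbers diverge: for every bound `M` there is `R ≥ 1` with `M ≤ H_R`
(Mathlib's `Real.tendsto_sum_range_one_div_nat_succ_atTop`). [folklore] -/
theorem exists_harmonicSum_ge (M : ℝ) : ∃ R : ℕ, 1 ≤ R ∧ M ≤ ∑ k ∈ range R, (1 : ℝ) / (k + 1) := by
  have h := Real.tendsto_sum_range_one_div_nat_succ_atTop
  rw [Filter.tendsto_atTop_atTop] at h
  obtain ⟨R, hR⟩ := h M
  exact ⟨max R 1, le_max_right _ _, hR _ (le_max_left _ _)⟩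

end Profile

/-! ### Assembly: the Mermin–Wagner theorem on the tori `(ℤ/Lℤ)^d`, `d ≤ 2` -/

section Assembly

variable {d : ℕ}

/-- **The local bound on the torus with the harmonic test function.** For `d ∈ {1, 2}`, `L ≥ 1`,
every spin `S = n/2`, couplings `J`, `h`, inverse temperature `β ≥ 0`, every `R ≥ 1` and every site
`o` of `(ℤ/Lℤ)^d`:
`(Re ⟨Ŝᶻ_o⟩_{β,L,h})² ≤ β S² (2|J| S² · 64/H_R + |h| S · 4R²)`, `H_R = Σ_{k<R} 1/(k+1)`,
uniformly in `L` (test function `f(x) = g(dist(x, o))`, `g(r) = (H_R - H_r)/H_R`). This replaces the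
`k`-space sum `N⁻¹ Σ_k (ω_k + |hσ|)⁻¹ ≳ |log|hσ||` of the printed proof (Mermin–Wagner (1966)
p. 1135; Gelfert–Nolting (2001) eqs. (49)–(52)) by its real-space counterpart, the vanishing
capacity of a point in `d ≤ 2`. [cite: MerminWagnerPRL1966, pp. 1133–1135] -/
theorem sq_re_gibbsState_siteSpin_torus_le (hd1 : 1 ≤ d) (hd2 : d ≤ 2) (L : ℕ) [NeZero L] (n : ℕ)
    (J h : ℝ) {β : ℝ} (hβ : 0 ≤ β) {R : ℕ} (hR : 1 ≤ R) (o : TorusSite d L) :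
    (gibbsState β (heisenbergTorusWithField d L n J h) (siteSpin n o 2)).re ^ 2 ≤
      β * ((n : ℝ) / 2) ^ 2 *
        (|J| * (2 * ((n : ℝ) / 2) ^ 2) * (64 / ∑ k ∈ range R, (1 : ℝ) / (k + 1)) +
          |h| * ((n : ℝ) / 2) * (4 * (R : ℝ) ^ 2)) := by
  set HR : ℝ := ∑ k ∈ range R, (1 : ℝ) / (k + 1) with hHR
  set g : ℕ → ℝ := fun r => (∑ k ∈ Ico r R, (1 : ℝ) / (k + 1)) / HR with hg
  set f : TorusSite d L → ℝ := fun x => g (torusDist x o) with hf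
  have hHR1 : 1 ≤ HR := one_le_sum_range_one_div_succ hR
  have hHR0 : 0 < HR := by linarith
  have hfo : f o = 1 := by
    simp only [hf, hg, torusDist_self]
    exact harmonicProfile_zero hR
  have hgR : ∀ r, R ≤ r → g r = 0 := fun r hr => harmonicProfile_eq_zero hr
  have hloc := sq_re_gibbsState_siteSpin_le n (torusGraph d L) J h hβ f o hfo
  -- the Dirichlet energy of `f`
  have hE : ∑ e ∈ (torusGraph d L).edgeFinset,
      Sym2.lift ⟨fun x y => (f x - f y) ^ 2, fun x y => by ring⟩ e ≤ 64 / HR := by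
    have h1 := sum_edgeFinset_radial_sq_le (L := L) g o
    have h2 := sum_radial_le_sum_range (L := L) hd1 hd2 (Φ := fun r => (g r - g (r + 1)) ^ 2)
      (fun r => sq_nonneg _) (R := R) (fun r hr => by
        simp only [hgR r hr, hgR (r + 1) (by omega), sub_self, ne_eq, OfNat.ofNat_ne_zero,
          not_false_eq_true, zero_pow]) o
    have h3 := sum_shell_harmonicProfile_sq_le hR
    have hd' : (4 : ℝ) * d ≤ 8 := by
      have : (d : ℝ) ≤ 2 := by exact_mod_cast hd2
      linarith
    have hsum0 : 0 ≤ ∑ u : TorusSite d L, (g (torusDist u o) - g (torusDist u o + 1)) ^ 2 :=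
      sum_nonneg fun u _ => sq_nonneg _
    calc _ ≤ 4 * d * ∑ u : TorusSite d L, (g (torusDist u o) - g (torusDist u o + 1)) ^ 2 := h1
      _ ≤ 8 * (8 / HR) := mul_le_mul hd' (h2.trans h3) hsum0 (by norm_num)
      _ = 64 / HR := by ring
  -- the mass of `f`
  have hF : ∑ x, (f x) ^ 2 ≤ 4 * (R : ℝ) ^ 2 := by
    have h1 := sum_radial_le_sum_range (L := L) hd1 hd2 (Φ := fun r => (g r) ^ 2)
      (fun r => sq_nonneg _) (R := R) (fun r hr => by
        simp only [hgR r hr, ne_eq, OfNat.ofNat_ne_zero, not_false_eq_true, zero_pow]) o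
    have h2 : ∑ r ∈ range R, 4 * (2 * (r : ℝ) + 1) * (g r) ^ 2 ≤
        ∑ r ∈ range R, 4 * (2 * (r : ℝ) + 1) * 1 := by
      refine sum_le_sum fun r _ => mul_le_mul_of_nonneg_left ?_ (by positivity)
      have h0 : 0 ≤ g r := harmonicProfile_nonneg R r
      have h1 : g r ≤ 1 := harmonicProfile_le_one R r
      nlinarith
    have h3 : ∑ r ∈ range R, 4 * (2 * (r : ℝ) + 1) * 1 = 4 * (R : ℝ) ^ 2 := by
      rw [← sum_range_two_mul_cast_add_one R, Finset.mul_sum]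
      refine sum_congr rfl fun r _ => ?_
      ring
    exact h1.trans (h2.trans h3.le)
  -- assemble
  have hS0 : 0 ≤ ((n : ℝ) / 2) := by positivity
  refine hloc.trans (mul_le_mul_of_nonneg_left (add_le_add ?_ ?_) (mul_nonneg hβ (sq_nonneg _)))
  · exact mul_le_mul_of_nonneg_left hE (by positivity)
  · exact mul_le_mul_of_nonneg_left hF (by positivity)

/-- **Mermin–Wagner's bound on the magnetisation, finite volume.** For `d ∈ {1, 2}`, every `L`
(junk value `0` at `L = 0`), `S = n/2`, `J`, `h`, `β ≥ 0` and `R ≥ 1`: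
`|m_L(β, h)| ≤ √(β S² (2|J| S² · 64/H_R + |h| S · 4R²))` with `H_R = Σ_{k<R} 1/(k+1) → ∞`.
(Mermin–Wagner's printed bound is `|s_z| ≤ const (T|ln|h||)^{-1/2}` in `d = 2`, obtained from the
same Bogoliubov inequality with plane-wave test functions; here the infrared divergence enters
through `H_R ~ log R`.) [cite: MerminWagnerPRL1966, pp. 1133–1135] -/
theorem abs_torusMagnetisation_le_sqrt (hd1 : 1 ≤ d) (hd2 : d ≤ 2) (L n : ℕ) (J h : ℝ) {β : ℝ}
    (hβ : 0 ≤ β) {R : ℕ} (hR : 1 ≤ R) :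
    |torusMagnetisation β d L n J h| ≤
      Real.sqrt (β * ((n : ℝ) / 2) ^ 2 *
        (|J| * (2 * ((n : ℝ) / 2) ^ 2) * (64 / ∑ k ∈ range R, (1 : ℝ) / (k + 1)) +
          |h| * ((n : ℝ) / 2) * (4 * (R : ℝ) ^ 2))) := by
  set B : ℝ := β * ((n : ℝ) / 2) ^ 2 *
    (|J| * (2 * ((n : ℝ) / 2) ^ 2) * (64 / ∑ k ∈ range R, (1 : ℝ) / (k + 1)) +
      |h| * ((n : ℝ) / 2) * (4 * (R : ℝ) ^ 2)) with hB
  rcases Nat.eq_zero_or_pos L with rfl | hL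
  · have h0 : torusMagnetisation β d 0 n J h = 0 := by simp [torusMagnetisation]
    rw [h0, abs_zero]
    exact Real.sqrt_nonneg _
  haveI : NeZero L := ⟨hL.ne'⟩
  set H := heisenbergTorusWithField d L n J h with hHdef
  have hsite : ∀ o : TorusSite d L, |(gibbsState β H (siteSpin n o 2)).re| ≤ Real.sqrt B :=
    fun o => Real.abs_le_sqrt (sq_re_gibbsState_siteSpin_torus_le hd1 hd2 L n J h hβ hR o)
  have hcard : (Fintype.card (TorusSite d L) : ℝ) = (L : ℝ) ^ d := by
    rw [Fintype.card_fun, ZMod.card, Fintype.card_fin]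
    push_cast
    rfl
  have hL0 : (0 : ℝ) < (L : ℝ) ^ d := by positivity
  have hm : torusMagnetisation β d L n J h =
      ((L : ℝ) ^ d)⁻¹ * ∑ o : TorusSite d L, (gibbsState β H (siteSpin n o 2)).re := by
    rw [torusMagnetisation_of_neZero, ← hHdef, LinearMap.map_smul, totalSpin, map_sum, smul_eq_mul,
      show ((L : ℂ) ^ d)⁻¹ = ((((L : ℝ) ^ d)⁻¹ : ℝ) : ℂ) by push_cast; rfl, Complex.re_ofReal_mul,
      Complex.re_sum]
  rw [hm, abs_mul, abs_of_pos (inv_pos.2 hL0)]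
  calc ((L : ℝ) ^ d)⁻¹ * |∑ o : TorusSite d L, (gibbsState β H (siteSpin n o 2)).re|
      ≤ ((L : ℝ) ^ d)⁻¹ * ∑ o : TorusSite d L, |(gibbsState β H (siteSpin n o 2)).re| :=
        mul_le_mul_of_nonneg_left (Finset.abs_sum_le_sum_abs _ _) (inv_nonneg.2 hL0.le)
    _ ≤ ((L : ℝ) ^ d)⁻¹ * ∑ _o : TorusSite d L, Real.sqrt B :=
        mul_le_mul_of_nonneg_left (sum_le_sum fun o _ => hsite o) (inv_nonneg.2 hL0.le)
    _ = Real.sqrt B := by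
        rw [sum_const, card_univ, nsmul_eq_mul, hcard, ← mul_assoc, inv_mul_cancel₀ hL0.ne', one_mul]

/-- **Discharge of `mermin_wagner_magnetisation` (hubbard.S12, Mermin–Wagner theorem, original
magnetisation form).** For `d ∈ {1, 2}`, every spin `S = n/2`, coupling `J` and `β > 0`, the
magnetisation per site of the Heisenberg model on `(ℤ/Lℤ)^d` in a field `h` satisfies
`∀ ε > 0, ∃ h₀ > 0, ∀ h ∈ (0, h₀), ∃ L₀, ∀ L ≥ L₀, |m_L(β, h)| < ε` — indeed with `L₀ = 0`, the bound
being uniform in the volume as in the source. Proof (Mermin–Wagner, PRL 17 (1966) 1133–1136, as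
surveyed in Gelfert–Nolting (2001) §3 and Mattis (2006) §7.15): Bogoliubov's inequality
(`bogoliubov_inequality`) with `C = Σ_x f_x Ŝˣ_x`, `A = Ŝʸ_o`, the bounds `⟨(Ŝʸ_o)²⟩ ≤ S²` and
`⟨[C,[H,C]]⟩ ≤ 2|J|S² Σ_{⟨xy⟩}(f_x - f_y)² + |h| S Σ_x f_x²` (`sq_re_gibbsState_siteSpin_le`), and —
in place of the plane waves and the `k`-space integral `∫ d^dk/(ω k² + |hσ|)` of the printed step (e) —
the radial test function `f = g(‖· - o‖)` with the harmonic profile, whose Dirichlet energy on the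
torus is `≤ 64/H_R → 0` in `d ≤ 2` while `Σ f² ≤ 4R²` (`abs_torusMagnetisation_le_sqrt`): given
`ε`, first choose `R` with `β S² · 2|J| S² · 64/H_R ≤ ε²/4`, then `h₀` with `β S³ · 4R² · h₀ ≤ ε²/4`.
[cite: MerminWagnerPRL1966, pp. 1133–1135 (main result: |s_z| < const (T|ln h|)^{-1/2} in d = 2, const T^{-2/3} h^{1/3} in d = 1)]
[cite: GelfertNolting2001, §2.3 eq. (9) and §3 eqs. (41)–(52)] [cite: Mattis2006, §7.15 eqs. (7.222)–(7.240)] -/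
theorem mermin_wagner_magnetisation_holds : mermin_wagner_magnetisation := by
  intro d hd1 hd2 n J β hβ ε hε
  set S : ℝ := (n : ℝ) / 2 with hS
  set K₁ : ℝ := β * S ^ 2 * (|J| * (2 * S ^ 2) * 64) with hK₁
  have hK₁0 : 0 ≤ K₁ := by positivity
  -- choose `R` with `K₁ / H_R ≤ ε²/4`
  obtain ⟨R, hR1, hR⟩ := exists_harmonicSum_ge (4 * K₁ / ε ^ 2)
  set HR : ℝ := ∑ k ∈ range R, (1 : ℝ) / (k + 1) with hHR
  have hHR1 : 1 ≤ HR := one_le_sum_range_one_div_succ hR1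
  have hHR0 : 0 < HR := by linarith
  have hfirst : K₁ / HR ≤ ε ^ 2 / 4 := by
    rw [div_le_iff₀ hHR0]
    have h1 : 4 * K₁ / ε ^ 2 * (ε ^ 2 / 4) = K₁ := by field_simp
    calc K₁ = 4 * K₁ / ε ^ 2 * (ε ^ 2 / 4) := h1.symm
      _ ≤ HR * (ε ^ 2 / 4) := mul_le_mul_of_nonneg_right hR (by positivity)
      _ = ε ^ 2 / 4 * HR := mul_comm _ _
  -- choose `h₀`
  set K₂ : ℝ := β * S ^ 2 * (S * (4 * (R : ℝ) ^ 2)) with hK₂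
  have hK₂0 : 0 ≤ K₂ := by positivity
  refine ⟨ε ^ 2 / (4 * K₂ + 4), by positivity, fun h hh0 hh1 => ⟨0, fun L _ => ?_⟩⟩
  have hsecond : K₂ * h ≤ ε ^ 2 / 4 := by
    have h1 : K₂ * h ≤ K₂ * (ε ^ 2 / (4 * K₂ + 4)) := mul_le_mul_of_nonneg_left hh1.le hK₂0
    have h2 : K₂ * (ε ^ 2 / (4 * K₂ + 4)) ≤ ε ^ 2 / 4 := by
      rw [mul_div_assoc', div_le_div_iff₀ (by positivity) (by positivity)]
      nlinarith [sq_nonneg ε]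
    exact h1.trans h2
  have hbound := abs_torusMagnetisation_le_sqrt hd1 hd2 L n J h hβ.le hR1
  rw [abs_of_pos hh0] at hbound
  have hBle : β * ((n : ℝ) / 2) ^ 2 *
      (|J| * (2 * ((n : ℝ) / 2) ^ 2) * (64 / ∑ k ∈ range R, (1 : ℝ) / (k + 1)) +
        h * ((n : ℝ) / 2) * (4 * (R : ℝ) ^ 2)) ≤ ε ^ 2 / 2 := by
    rw [← hS, ← hHR]
    have e1 : β * S ^ 2 * (|J| * (2 * S ^ 2) * (64 / HR) + h * S * (4 * (R : ℝ) ^ 2)) =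
        K₁ / HR + K₂ * h := by
      rw [hK₁, hK₂]
      field_simp
    rw [e1]
    linarith
  refine lt_of_le_of_lt hbound ?_
  rw [Real.sqrt_lt' hε]
  nlinarith [sq_nonneg ε]

end Assembly

end Literature.MathematicalPhysics.QuantumLattice
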